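import Summits.CriticalPhenomena.PercolationContinuityZ3.Theorems.PercNearOneGluingNoHeavyLowerTailSunflowerRainbowLinearDichotomy
import HarnessLib
import HarnessLib.Audit

/-!
# `NoHeavyLowerTail` (crux stmt-CriticalPhenomena-4575), abstract sunflower cubic: the EXISTENTIAL linear-extension rainbow dichotomy —
# the repair of `RainbowLinearDichotomy` (gen 22; FALSE, gen 25) that still gives `RainbowMatroidPartition`

Support file (seat `prim-l12-p2` gen 25; `--supports stmt-CriticalPhenomena-4575`).  No `sorry`.  One new definition, the `@[conjecture]`
`RainbowSomeLinearDichotomy` (an obligation of this programme — census-true, unproved —, never a fact).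
Memo: run/shared/lean/prim/prim-l12/prim-l12-p2/FINDING-g25-ADVERSARIAL-CENSUS-AND-STRUCTURE.md (§1, §7).

STATUS OF `RainbowLinearDichotomy` (ZZ_L: the dichotomy along EVERY linear extension of `RbBelow`): **FALSE** — `not_rainbowLinearDichotomy`
(`…SunflowerRainbowLinearDichotomyRefutation`, gen 25): on 7 points a B-DEAD rainbow `ρ` (`TS-B ρ = 0`, so `ρ` is B-dependent on any earlier set)
can have `TS-A ρ` equal to the `TS-A` of an `RbBelow`-INCOMPARABLE rainbow `ρ'`, and a linear extension may put `ρ` first.  The adversarial census of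
gen 25 produced 2 912 such sunflowers on 7 and 8 points; in 247 of them even the natural "B-alive first" topological order fails.  But in EVERY one of them
SOME linear extension of `RbBelow` satisfies the dichotomy (found by heuristic or randomised search, memo §1), and ONE rank is all that
`Sunflower.exists_matroidPartition_of_rank` needs.

THE REPAIR (this file).
* `RainbowSomeLinearDichotomy` (conjecture (ZZ_∃)): for every sunflower THERE IS an injective rank `r` on the rainbows, strictly monotone along
  `RbBelow`, such that no rainbow `ρ` has both `TS-B ρ ∈ span {TS-B ρ' : r ρ' < r ρ}` and `TS-A ρ ∈ span {TS-A ρ' : r ρ < r ρ'}`.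
  CENSUS (gen 25): all 2 912 (ZZ_L)-refuting sunflowers (7 and 8 points) admit such a rank; wherever (ZZ_L) held (gens 22–24: n ≤ 5 exhaustive,
  ≈ 2·10⁶ compositions / random / structured instances on ≤ 9 points, 6.6·10⁶ random linear extensions) every rank works; kit jobs j156991 / j156995
  (simulated annealing with an existence search) attack it directly.  (ZZ_L) ⟹ (ZZ_∃) (`rainbowSomeLinearDichotomy_of_rainbowLinearDichotomy`,
  recorded only to place the two statements; the hypothesis is refuted).
* **`rainbowMatroidPartition_of_rainbowSomeLinearDichotomy`** : (ZZ_∃) ⟹ MP, and **`partitionLemmaH_of_rainbowSomeLinearDichotomy`** : (ZZ_∃) ⟹ ★.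
-/

namespace Summit.CriticalPhenomena.PercolationContinuityZ3.Theorems.SunflowerPartition

open Finset

/-- **EXISTENTIAL LINEAR-EXTENSION RAINBOW DICHOTOMY** (this work; OPEN; the repair of the refuted `RainbowLinearDichotomy`): every sunflower admits an
injective rank on its rainbows, strictly monotone along the product order `RbBelow`, along which no rainbow is both B-dependent on the earlier rainbows and
A-dependent on the later ones.  An obligation, never a fact: use as `(h : RainbowSomeLinearDichotomy)`. [status: open] -/
@[conjecture] def RainbowSomeLinearDichotomy : Prop :=
  ∀ (α : Type) [Fintype α] [DecidableEq α] (F : Sunflower α), ∃ r : Finset α × Finset α → ℕ,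
    Set.InjOn r ↑F.rainbows ∧
    (∀ ρ' ρ, ρ' ∈ F.rainbows → ρ ∈ F.rainbows → RbBelow ρ' ρ → r ρ' < r ρ) ∧
    ∀ ρ ∈ F.rainbows, ¬ (F.tsB ρ ∈ Submodule.span (ZMod 2) (F.tsB '' {ρ' | ρ' ∈ F.rainbows ∧ r ρ' < r ρ}) ∧
                       F.tsA ρ ∈ Submodule.span (ZMod 2) (F.tsA '' {ρ' | ρ' ∈ F.rainbows ∧ r ρ < r ρ'}))

/-- (ZZ_L) ⟹ (ZZ_∃): the universal form implies the existential one (a linear extension of `RbBelow` exists, `exists_rank_linearExtension`).  Recorded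
only to place the two statements — the hypothesis is FALSE (`not_rainbowLinearDichotomy`, gen 25). [this work] -/
theorem rainbowSomeLinearDichotomy_of_rainbowLinearDichotomy (h : RainbowLinearDichotomy) : RainbowSomeLinearDichotomy := by
  intro α _ _ F
  obtain ⟨r, hinj, hmono⟩ := exists_rank_linearExtension F
  exact ⟨r, hinj, hmono, h α F r hinj hmono⟩

/-- **(ZZ_∃) ⟹ MP** (this work): one rank with the dichotomy yields the matroid partition (`Sunflower.exists_matroidPartition_of_rank`, gen 22). [this work] -/
theorem rainbowMatroidPartition_of_rainbowSomeLinearDichotomy (h : RainbowSomeLinearDichotomy) : RainbowMatroidPartition := by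
  intro α _ _ F
  obtain ⟨r, hinj, -, hd⟩ := h α F
  exact F.exists_matroidPartition_of_rank r hinj hd

/-- **(ZZ_∃) ⟹ ★** (this work). [this work] -/
theorem partitionLemmaH_of_rainbowSomeLinearDichotomy (h : RainbowSomeLinearDichotomy) : PartitionLemmaH :=
  partitionLemmaH_of_rainbowMatroidPartition (rainbowMatroidPartition_of_rainbowSomeLinearDichotomy h)

end Summit.CriticalPhenomena.PercolationContinuityZ3.Theorems.SunflowerPartition
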